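import Literature.NumberTheory.Sieve.SmoothMinorArcs
import Mathlib.NumberTheory.DiophantineApproximation.Basic
import HarnessLib

/-!
# The pointwise minor-arc bound (Proposition 5 of Harper 2016, our form)

Topic `Literature/NumberTheory/Sieve`; a PROVED file toward
`Literature.NumberTheory.DiophantineGeometry.XYZUpperHalf` ([Harper2016, Cor. 1]). Proposition 5
of op. cit. (§5): for `θ` off the major arcs, `|∑_{n ≤ x, n∈S(y)} e(nθ)| ≪ Ψ(x,y)/log⁵ x`. We prove
the version used downstream, with major arcs `𝔐(R) = ⋃_{q ≤ R} ⋃_a {|θ − a/q| ≤ R/x}` (as in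
op. cit.) and an explicit dependence on `R`: by
Dirichlet's theorem (`Real.exists_rat_abs_sub_le_and_den_le` at level `x^{4/5}`) `θ = a/q + δ` with
`(a, q) = 1`, `q ≤ x^{4/5}`, `|δ| ≤ 1/(q x^{4/5})`; then

* `q ≤ R`: `θ ∉ 𝔐` forces `|δ| > R/x`, and Theorem 1 (`norm_smoothExpSum_le`) applies with
  `qL ≥ L > 2R`;
* `R < q ≤ √x/(4y²)`: Theorem 1 with `qL ≥ q > R`;
* `√x/(4y²) < q`: the crude bound `norm_smoothExpSum_le_crude` with `W₀ = √x`, `K₀ = y`.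

`norm_smoothExpSum_le_of_minor`: for `x ≥ x₀`, `(log x)^4 ≤ y`, `log y ≤ (log x)^{1/6}`,
`y^{40} ≤ x`, `1 ≤ R ≤ x^{1/5}` and `θ ∉ 𝔐(R)`:
`|∑_{n ≤ x, n∈S(y)} e(nθ)| ≤ C (log x)³ y^{(5/2)(1−α)} R^{−1/2+(3/2)(1−α)} x^α ζ(α,y)/√φ₂(α,y)
   + 41 (1 + log x)² y² x^{9/10}`.

## References

* A. J. Harper, Compositio Math. 152 (2016) 1121–1158, §5, Proposition 5 [Harper2016].
-/

noncomputable section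

open Finset Real
open scoped FourierTransform
open Literature.NumberTheory.Sieve.Vinogradov

namespace Literature.NumberTheory.Sieve

/-- **`α(x, y) ≥ 17/20`** in the range `(log x)^8 ≤ y ≤ x`, `x ≥ x₀`
(from `y^{1−α} ≪ u log(u+1) ≤ y^{1/8} · y^{1/40}`). [cite: HildebrandTenenbaum1986, Lemma 2 (3.4)–(3.5)] -/
theorem seventeen_twentieths_le_saddlePoint :
    ∃ x₀ : ℝ, ∀ (x : ℝ) (y : ℕ), x₀ ≤ x → Real.log x ^ 8 ≤ y → (y : ℝ) ≤ x →
      17 / 20 ≤ saddlePoint x y := by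
  obtain ⟨C, x₁, hC, hA⟩ := rpow_one_sub_saddlePoint_le
  obtain ⟨Y, hY1, hY⟩ :=
    exists_log_le_mul_rpow (κ := 1 / C) (ε := 1 / 40) (by positivity) (by norm_num)
  refine ⟨max x₁ (Real.exp (max Y 8)), fun x y hx hlx hyx => ?_⟩
  have hx₁ : x₁ ≤ x := le_trans (le_max_left _ _) hx
  have hlogx : max Y 8 ≤ Real.log x := by
    have := Real.log_le_log (Real.exp_pos _) (le_trans (le_max_right _ _) hx)
    rwa [Real.log_exp] at this
  have hlogx8 : 8 ≤ Real.log x := le_trans (le_max_right _ _) hlogx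
  have hL1 : 1 ≤ Real.log x := by linarith
  have hlx3 : Real.log x ^ 3 ≤ y := le_trans (pow_le_pow_right₀ hL1 (by norm_num)) hlx
  have hlogx_le_y : Real.log x ≤ y := by
    calc Real.log x = Real.log x ^ 1 := (pow_one _).symm
      _ ≤ Real.log x ^ 8 := pow_le_pow_right₀ hL1 (by norm_num)
      _ ≤ y := hlx
  have hyY : Y ≤ y := by linarith [le_max_left Y 8]
  have hy8r : (8 : ℝ) ≤ y := by linarith
  have hy0 : (0 : ℝ) < y := by linarith
  have hy1 : (1 : ℝ) < y := by linarith
  have hlogy1 : 1 ≤ Real.log y := by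
    have : Real.exp 1 ≤ y := by
      have := Real.exp_one_lt_d9; linarith
    have := Real.log_le_log (Real.exp_pos 1) this
    rwa [Real.log_exp] at this
  set u : ℝ := Real.log x / Real.log y with hu
  have huL : u ≤ Real.log x := by rw [hu]; exact div_le_self (by linarith) hlogy1
  have hu1 : 1 ≤ u := by
    rw [hu, le_div_iff₀ (by linarith)]
    rw [one_mul]; exact Real.log_le_log hy0 hyx
  have hlogu0 : 0 < Real.log (u + 1) := Real.log_pos (by linarith)
  -- `log x ≤ y^{1/8}`
  have huy : u ≤ (y : ℝ) ^ (1 / 8 : ℝ) := by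
    refine huL.trans ?_
    calc Real.log x = (Real.log x ^ (8 : ℕ)) ^ (1 / 8 : ℝ) := by
          rw [← Real.rpow_natCast, ← Real.rpow_mul (by linarith)]; norm_num
      _ ≤ (y : ℝ) ^ (1 / 8 : ℝ) := Real.rpow_le_rpow (by positivity) hlx (by norm_num)
  have hlogu : Real.log (u + 1) ≤ Real.log y := by
    apply Real.log_le_log (by linarith)
    have h1 : (y : ℝ) ^ (1 / 8 : ℝ) ≤ (y : ℝ) ^ (1 / 2 : ℝ) := Real.rpow_le_rpow_of_exponent_le hy1.le (by norm_num)
    have h2 : (y : ℝ) ^ (1 / 2 : ℝ) * (y : ℝ) ^ (1 / 2 : ℝ) = y := by rw [← Real.rpow_add hy0]; norm_num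
    have h3 : (2 : ℝ) ≤ (y : ℝ) ^ (1 / 2 : ℝ) := by
      calc (2 : ℝ) = (4 : ℝ) ^ (1 / 2 : ℝ) := by
            rw [show (4 : ℝ) = 2 ^ (2 : ℕ) by norm_num, ← Real.rpow_natCast, ← Real.rpow_mul (by norm_num)]; norm_num
        _ ≤ (y : ℝ) ^ (1 / 2 : ℝ) := Real.rpow_le_rpow (by norm_num) (by linarith) (by norm_num)
    nlinarith
  have h := hA x y hx₁ hlx3 hyx
  have hbound : C * (u * Real.log (u + 1)) ≤ (y : ℝ) ^ (3 / 20 : ℝ) := by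
    have h1 := hY y hyY
    calc C * (u * Real.log (u + 1)) ≤ C * ((y : ℝ) ^ (1 / 8 : ℝ) * Real.log y) :=
          mul_le_mul_of_nonneg_left
            (mul_le_mul huy hlogu hlogu0.le (Real.rpow_nonneg hy0.le _)) hC.le
      _ ≤ C * ((y : ℝ) ^ (1 / 8 : ℝ) * (1 / C * (y : ℝ) ^ (1 / 40 : ℝ))) :=
          mul_le_mul_of_nonneg_left
            (mul_le_mul_of_nonneg_left h1 (Real.rpow_nonneg hy0.le _)) hC.le
      _ = (y : ℝ) ^ (1 / 8 : ℝ) * (y : ℝ) ^ (1 / 40 : ℝ) := by field_simp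
      _ = (y : ℝ) ^ (3 / 20 : ℝ) := by rw [← Real.rpow_add hy0]; norm_num
  have h2 : (y : ℝ) ^ (1 - saddlePoint x y) ≤ (y : ℝ) ^ (3 / 20 : ℝ) := le_trans h hbound
  have h3 : 1 - saddlePoint x y ≤ 3 / 20 := (Real.rpow_le_rpow_left_iff hy1).1 h2
  linarith

/-- Numerical bookkeeping for the crude range in `norm_smoothExpSum_le_of_minor`:
with `X2 = x^{1/2}`, `QD = x^{4/5}`, `X2/(4y²) < q ≤ QD`, the bound of
`norm_smoothExpSum_le_crude` (`W₀ = X2`, `K₀ = y`) is at most `41 (1 + log x)² y² x^{9/10}`. [folklore] -/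
theorem crude_bound_aux {x Lx X2 QD : ℝ} {y q : ℕ} (hx1 : 1 < x) (hLx : Lx = Real.log x)
    (hy1 : 1 ≤ (y : ℝ)) (hq0 : 0 < (q : ℝ)) (hq1r : 1 ≤ (q : ℝ)) (hX2 : X2 = x ^ (1 / 2 : ℝ))
    (hQD : QD = x ^ (4 / 5 : ℝ)) (hqQD : (q : ℝ) ≤ QD) (hqlarge : X2 / (4 * (y : ℝ) ^ 2) < q)
    (hlogyL : Real.log y ≤ Lx) :
    X2 + 2 * (1 + Real.log y) * Real.sqrt (2 * x) *
        Real.sqrt (10 * X2 * y * (1 + Real.log y) + 32 * y * x * y / q +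
          16 * y * x * (y : ℝ) ^ 2 * (1 + Real.log q) / X2 + 4 * y * q * (1 + Real.log q)) ≤
      41 * (1 + Lx) ^ 2 * (y : ℝ) ^ 2 * x ^ (9 / 10 : ℝ) := by
  have hx0 : 0 < x := by linarith
  have hLx0 : 0 ≤ Lx := by rw [hLx]; exact Real.log_nonneg hx1.le
  have hy0 : (0 : ℝ) < y := by linarith
  have hX2_0 : 0 < X2 := by rw [hX2]; positivity
  have hQD0 : 0 < QD := by rw [hQD]; positivity
  have hX2sq : X2 * X2 = x := by rw [hX2, ← Real.rpow_add hx0]; norm_num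
  have hQDX5 : QD * x ^ (1 / 5 : ℝ) = x := by rw [hQD, ← Real.rpow_add hx0]; norm_num
  have hx910 : x ^ (9 / 10 : ℝ) = QD * x ^ (1 / 10 : ℝ) := by rw [hQD, ← Real.rpow_add hx0]; norm_num
  have hX2QD : X2 ≤ QD := by
    rw [hX2, hQD]; exact Real.rpow_le_rpow_of_exponent_le hx1.le (by norm_num)
  have hlogq : Real.log q ≤ Lx := by
    rw [hLx]; apply Real.log_le_log hq0
    calc (q : ℝ) ≤ QD := hqQD
      _ ≤ x := by
          calc QD = QD * 1 := (mul_one _).symm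
            _ ≤ QD * x ^ (1 / 5 : ℝ) := by gcongr; exact Real.one_le_rpow hx1.le (by norm_num)
            _ = x := hQDX5
  have hlogq0 : 0 ≤ Real.log q := Real.log_nonneg hq1r
  have hy4 : (y : ℝ) ≤ (y : ℝ) ^ 4 := by
    calc (y : ℝ) = (y : ℝ) ^ 1 := (pow_one _).symm
      _ ≤ (y : ℝ) ^ 4 := pow_le_pow_right₀ hy1 (by norm_num)
  have hy34 : (y : ℝ) ^ 3 ≤ (y : ℝ) ^ 4 := pow_le_pow_right₀ hy1 (by norm_num)
  set T₀ : ℝ := (y : ℝ) ^ 4 * QD * (1 + Lx) with hT₀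
  have hT₀0 : 0 ≤ T₀ := by positivity
  have hQDL : QD ≤ QD * (1 + Lx) := le_mul_of_one_le_right hQD0.le (by linarith only [hLx0])
  have ht1 : 10 * X2 * y * (1 + Real.log y) ≤ 10 * T₀ := by
    rw [hT₀]
    calc 10 * X2 * y * (1 + Real.log y) = 10 * (y * X2 * (1 + Real.log y)) := by ring
      _ ≤ 10 * ((y : ℝ) ^ 4 * QD * (1 + Lx)) := by gcongr
  have ht2 : 32 * (y : ℝ) * x * y / q ≤ 128 * T₀ := by
    rw [hT₀, div_le_iff₀ hq0]
    have h1 : X2 < 4 * (y : ℝ) ^ 2 * q := by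
      rw [div_lt_iff₀ (by positivity)] at hqlarge; linarith only [hqlarge]
    have h2 : 32 * (y : ℝ) * x * y = 32 * (y : ℝ) ^ 2 * X2 * X2 := by rw [← hX2sq]; ring
    rw [h2]
    calc 32 * (y : ℝ) ^ 2 * X2 * X2 ≤ 32 * (y : ℝ) ^ 2 * X2 * (4 * (y : ℝ) ^ 2 * q) := by gcongr
      _ = 128 * ((y : ℝ) ^ 4 * X2) * q := by ring
      _ ≤ 128 * ((y : ℝ) ^ 4 * (QD * (1 + Lx))) * q := by gcongr; exact hX2QD.trans hQDL
      _ = 128 * ((y : ℝ) ^ 4 * QD * (1 + Lx)) * q := by ring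
  have ht3 : 16 * (y : ℝ) * x * (y : ℝ) ^ 2 * (1 + Real.log q) / X2 ≤ 16 * T₀ := by
    rw [hT₀, div_le_iff₀ hX2_0]
    calc 16 * (y : ℝ) * x * (y : ℝ) ^ 2 * (1 + Real.log q) = 16 * ((y : ℝ) ^ 3 * (X2 * (1 + Real.log q))) * X2 := by
          rw [← hX2sq]; ring
      _ ≤ 16 * ((y : ℝ) ^ 4 * (QD * (1 + Lx))) * X2 := by gcongr
      _ = 16 * ((y : ℝ) ^ 4 * QD * (1 + Lx)) * X2 := by ring
  have ht4 : 4 * (y : ℝ) * q * (1 + Real.log q) ≤ 4 * T₀ := by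
    rw [hT₀]
    calc 4 * (y : ℝ) * q * (1 + Real.log q) = 4 * (y * q * (1 + Real.log q)) := by ring
      _ ≤ 4 * ((y : ℝ) ^ 4 * QD * (1 + Lx)) := by gcongr
  have hroot : 10 * X2 * y * (1 + Real.log y) + 32 * y * x * y / q +
      16 * y * x * (y : ℝ) ^ 2 * (1 + Real.log q) / X2 + 4 * y * q * (1 + Real.log q) ≤ 200 * T₀ := by
    linarith only [ht1, ht2, ht3, ht4, hT₀0]
  have hxQD : x * QD = (x ^ (9 / 10 : ℝ)) ^ 2 := by
    rw [hQD, ← Real.rpow_natCast,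
      ← Real.rpow_mul hx0.le, show x * x ^ (4 / 5 : ℝ) = x ^ (1 : ℝ) * x ^ (4 / 5 : ℝ) by rw [Real.rpow_one],
      ← Real.rpow_add hx0]
    norm_num
  have hprod : 2 * x * (200 * T₀) = (20 * (y : ℝ) ^ 2 * x ^ (9 / 10 : ℝ)) ^ 2 * (1 + Lx) := by
    rw [hT₀]
    calc 2 * x * (200 * ((y : ℝ) ^ 4 * QD * (1 + Lx))) = 400 * (y : ℝ) ^ 4 * (x * QD) * (1 + Lx) := by ring
      _ = _ := by rw [hxQD]; ring
  have hsq : Real.sqrt (2 * x) * Real.sqrt (200 * T₀) = 20 * (y : ℝ) ^ 2 * x ^ (9 / 10 : ℝ) * Real.sqrt (1 + Lx) := by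
    rw [← Real.sqrt_mul (by positivity), hprod, Real.sqrt_mul (by positivity), Real.sqrt_sq (by positivity)]
  have hsqrtL : Real.sqrt (1 + Lx) ≤ 1 + Lx :=
    Real.sqrt_le_iff.mpr ⟨by linarith only [hLx0], by nlinarith only [hLx0]⟩
  have hx10 : (1 : ℝ) ≤ x ^ (1 / 10 : ℝ) := Real.one_le_rpow hx1.le (by norm_num)
  have hone : (1 : ℝ) ≤ (1 + Lx) ^ 2 * (y : ℝ) ^ 2 :=
    one_le_mul_of_one_le_of_one_le (one_le_pow₀ (by linarith only [hLx0])) (one_le_pow₀ hy1)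
  calc X2 + 2 * (1 + Real.log y) * Real.sqrt (2 * x) *
        Real.sqrt (10 * X2 * y * (1 + Real.log y) + 32 * y * x * y / q +
          16 * y * x * (y : ℝ) ^ 2 * (1 + Real.log q) / X2 + 4 * y * q * (1 + Real.log q))
      ≤ X2 + 2 * (1 + Lx) * Real.sqrt (2 * x) * Real.sqrt (200 * T₀) := by gcongr
    _ = X2 + 2 * (1 + Lx) * (20 * (y : ℝ) ^ 2 * x ^ (9 / 10 : ℝ) * Real.sqrt (1 + Lx)) := by
        rw [mul_assoc (2 * (1 + Lx)), hsq]
    _ ≤ QD * x ^ (1 / 10 : ℝ) + 2 * (1 + Lx) * (20 * (y : ℝ) ^ 2 * x ^ (9 / 10 : ℝ) * (1 + Lx)) := by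
        gcongr
        calc X2 ≤ QD := hX2QD
          _ = QD * 1 := (mul_one _).symm
          _ ≤ QD * x ^ (1 / 10 : ℝ) := by gcongr
    _ = x ^ (9 / 10 : ℝ) * (1 + 40 * ((1 + Lx) ^ 2 * (y : ℝ) ^ 2)) := by rw [hx910]; ring
    _ ≤ x ^ (9 / 10 : ℝ) * (41 * ((1 + Lx) ^ 2 * (y : ℝ) ^ 2)) := by
        apply mul_le_mul_of_nonneg_left _ (by positivity)
        linarith only [hone]
    _ = 41 * (1 + Lx) ^ 2 * (y : ℝ) ^ 2 * x ^ (9 / 10 : ℝ) := by ring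

set_option maxHeartbeats 3000000 in
-- a long assembly with a large context
/-- **Proposition 5 (pointwise minor-arc bound), our form.** See the module docstring.
[cite: Harper2016, §5, Proposition 5 and its proof] -/
theorem norm_smoothExpSum_le_of_minor :
    ∃ C x₀ : ℝ, 0 < C ∧ ∀ (x : ℝ) (y : ℕ), x₀ ≤ x → Real.log x ^ 8 ≤ y →
      Real.log y ≤ Real.log x ^ (1 / 6 : ℝ) → (y : ℝ) ^ 40 ≤ x → ∀ (R : ℝ), 1 ≤ R → R ≤ x ^ (1 / 5 : ℝ) →
      ∀ θ : ℝ, (∀ q : ℕ, 1 ≤ q → (q : ℝ) ≤ R → ∀ a : ℤ, R / x < |θ - a / q|) →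
        ‖∑ n ∈ Nat.smoothNumbersUpTo ⌊x⌋₊ (y + 1), (𝐞 ((n : ℝ) * θ) : ℂ)‖ ≤
          C * Real.log x ^ 3 * (y : ℝ) ^ (5 / 2 * (1 - saddlePoint x y)) *
            R ^ (-(1 / 2 : ℝ) + 3 / 2 * (1 - saddlePoint x y)) *
            (x ^ saddlePoint x y *
              (smoothZeta (saddlePoint x y) y / Real.sqrt (saddlePhi₂ (saddlePoint x y) y))) +
          41 * (1 + Real.log x) ^ 2 * (y : ℝ) ^ 2 * x ^ (9 / 10 : ℝ) := by
  classical
  obtain ⟨C, x₀T, hC, hT⟩ := norm_smoothExpSum_le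
  obtain ⟨x₀F, h1720⟩ := seventeen_twentieths_le_saddlePoint
  obtain ⟨x₀1, hlt1⟩ := saddlePoint_lt_one
  refine ⟨C, max (max x₀T x₀F) (max x₀1 (Real.exp 16)), hC,
    fun x y hx hy8log hy6 hy40 R hR1 hRx θ hminor => ?_⟩
  have hx₀T : x₀T ≤ x := le_trans ((le_max_left _ _).trans (le_max_left _ _)) hx
  have hx₀F : x₀F ≤ x := le_trans ((le_max_right _ _).trans (le_max_left _ _)) hx
  have hx₀1 : x₀1 ≤ x := le_trans ((le_max_left _ _).trans (le_max_right _ _)) hx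
  have hxe : Real.exp 16 ≤ x := le_trans ((le_max_right _ _).trans (le_max_right _ _)) hx
  ------------------------------------------------------------------
  -- ### the range
  set Lx := Real.log x with hLx
  have hLx16 : 16 ≤ Lx := by
    have := Real.log_le_log (Real.exp_pos _) hxe; rwa [Real.log_exp] at this
  have hx16 : (16 : ℝ) ≤ x := by
    have h1 : (16 : ℝ) ≤ Real.exp 16 := by have := Real.add_one_le_exp (16 : ℝ); linarith
    exact h1.trans hxe
  have hx1 : 1 < x := by linarith
  have hx0 : 0 < x := by linarith
  have hLx1 : 1 ≤ Lx := by linarith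
  have hLx0 : 0 ≤ Lx := by linarith
  have hy4 : Lx ^ 4 ≤ y := le_trans (pow_le_pow_right₀ hLx1 (by norm_num)) hy8log
  have hyL : Lx ≤ y := by
    calc Lx = Lx ^ 1 := (pow_one _).symm
      _ ≤ Lx ^ 4 := pow_le_pow_right₀ hLx1 (by norm_num)
      _ ≤ y := hy4
  have hy16 : (16 : ℝ) ≤ y := by linarith
  have hy2 : 2 ≤ y := by exact_mod_cast (show (2 : ℝ) ≤ y by linarith)
  have hy0 : (0 : ℝ) < y := by linarith
  have hy1 : (1 : ℝ) ≤ y := by linarith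
  have hlogy : 0 ≤ Real.log y := Real.log_nonneg hy1
  have hlogyL : Real.log y ≤ Lx := by
    refine hy6.trans ?_
    calc Lx ^ (1 / 6 : ℝ) ≤ Lx ^ (1 : ℝ) := Real.rpow_le_rpow_of_exponent_le hLx1 (by norm_num)
      _ = Lx := Real.rpow_one _
  have hyx : (y : ℝ) ≤ x := by
    rw [← Real.exp_log hy0, ← Real.exp_log hx0]; exact Real.exp_le_exp.mpr hlogyL
  have hy3 : Real.log x ^ 3 ≤ y := le_trans (pow_le_pow_right₀ hLx1 (by norm_num)) hy4
  set α := saddlePoint x y with hαdef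
  have hα1720 : 17 / 20 ≤ α := h1720 x y hx₀F hy8log hyx
  have hα1 : α ≤ 1 := (hlt1 x y hx₀1 hy3 hyx hy6).le
  set e : ℝ := -(1 / 2 : ℝ) + 3 / 2 * (1 - α) with he
  have he0 : e ≤ 0 := by rw [he]; linarith
  set 𝓟 : ℝ := x ^ α * (smoothZeta α y / Real.sqrt (saddlePhi₂ α y)) with h𝓟
  have h𝓟0 : 0 ≤ 𝓟 := by
    have : 0 < smoothZeta α y := smoothZeta_pos (by linarith)
    positivity
  set MainB : ℝ := C * Lx ^ 3 * (y : ℝ) ^ (5 / 2 * (1 - α)) * R ^ e * 𝓟 with hMainB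
  have hMainB0 : 0 ≤ MainB := by positivity
  set CrudeB : ℝ := 41 * (1 + Lx) ^ 2 * (y : ℝ) ^ 2 * x ^ (9 / 10 : ℝ) with hCrudeB
  have hCrudeB0 : 0 ≤ CrudeB := by positivity
  -- powers of `x`
  set X5 : ℝ := x ^ (1 / 5 : ℝ) with hX5
  set X2 : ℝ := x ^ (1 / 2 : ℝ) with hX2
  set QD : ℝ := x ^ (4 / 5 : ℝ) with hQD
  have hX5_1 : 1 ≤ X5 := Real.one_le_rpow hx1.le (by norm_num)
  have hX2_1 : 1 ≤ X2 := Real.one_le_rpow hx1.le (by norm_num)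
  have hQD_1 : 1 ≤ QD := Real.one_le_rpow hx1.le (by norm_num)
  have hX5pow : X5 ^ (5 : ℕ) = x := by
    rw [hX5, ← Real.rpow_natCast, ← Real.rpow_mul hx0.le]; norm_num
  have hX2sq : X2 * X2 = x := by
    rw [hX2, ← Real.rpow_add hx0]; norm_num
  have hQDX5 : QD * X5 = x := by
    rw [hQD, hX5, ← Real.rpow_add hx0]; norm_num
  have hQD4 : QD = X5 ^ (4 : ℕ) := by
    rw [hQD, hX5, ← Real.rpow_natCast, ← Real.rpow_mul hx0.le]; norm_num
  have hx910 : x ^ (9 / 10 : ℝ) = QD * x ^ (1 / 10 : ℝ) := by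
    rw [hQD, ← Real.rpow_add hx0]; norm_num
  have hX2_X5 : X2 = X5 ^ (2 : ℕ) * x ^ (1 / 10 : ℝ) := by
    rw [hX2, hX5, ← Real.rpow_natCast, ← Real.rpow_mul hx0.le, ← Real.rpow_add hx0]; norm_num
  -- `y^{40} ≤ x` gives `y^8 ≤ X5`
  have hy8 : (y : ℝ) ^ (8 : ℕ) ≤ X5 := by
    have h1 : ((y : ℝ) ^ (8 : ℕ)) ^ (5 : ℕ) ≤ X5 ^ (5 : ℕ) := by
      rw [← pow_mul, hX5pow]; exact hy40
    exact le_of_pow_le_pow_left₀ (by norm_num) (by positivity) h1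
  have hy2_8 : (y : ℝ) ^ 2 ≤ (y : ℝ) ^ (8 : ℕ) := pow_le_pow_right₀ hy1 (by norm_num)
  have hy4_8 : (y : ℝ) ^ 4 ≤ (y : ℝ) ^ (8 : ℕ) := pow_le_pow_right₀ hy1 (by norm_num)
  have hy3_8 : (y : ℝ) ^ 3 ≤ (y : ℝ) ^ (8 : ℕ) := pow_le_pow_right₀ hy1 (by norm_num)
  ------------------------------------------------------------------
  -- ### Dirichlet
  obtain ⟨ρ, hρ, hρden⟩ := Real.exists_rat_abs_sub_le_and_den_le θ (Nat.floor_pos.mpr hQD_1)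
  set q : ℕ := ρ.den with hq
  set a : ℤ := ρ.num with ha
  have hq1 : 1 ≤ q := ρ.den_pos
  have hq0 : (0 : ℝ) < q := by exact_mod_cast hq1
  have hq1r : (1 : ℝ) ≤ q := by exact_mod_cast hq1
  have hcop : IsCoprime a (q : ℤ) := by rw [ha, hq]; exact Rat.isCoprime_num_den ρ
  have hρeq : (ρ : ℝ) = (a : ℝ) / q := by rw [ha, hq]; exact_mod_cast (Rat.num_div_den ρ).symm
  set δ : ℝ := θ - (a : ℝ) / q with hδ
  have hθ : θ = (a : ℝ) / q + δ := by rw [hδ]; ring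
  have hqQD : (q : ℝ) ≤ QD := le_trans (by exact_mod_cast hρden) (Nat.floor_le (by positivity))
  have hδQ : |δ| * (q * QD) ≤ 1 := by
    have h1 : |δ| ≤ 1 / ((⌊QD⌋₊ + 1) * q) := by rw [hδ, ← hρeq]; exact hρ
    have h2 : QD ≤ (⌊QD⌋₊ : ℝ) + 1 := (Nat.lt_floor_add_one QD).le
    rw [le_div_iff₀ (by positivity)] at h1
    calc |δ| * (q * QD) ≤ |δ| * (q * ((⌊QD⌋₊ : ℝ) + 1)) := by gcongr
      _ = |δ| * ((⌊QD⌋₊ + 1) * q) := by ring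
      _ ≤ 1 := h1
  have hδx : |δ| * x * q ≤ X5 := by
    calc |δ| * x * q = |δ| * (q * QD) * X5 := by rw [← hQDX5]; ring
      _ ≤ 1 * X5 := by gcongr
      _ = X5 := one_mul _
  set L : ℝ := 2 * (1 + |δ| * x) with hL
  have hL2 : 2 ≤ L := by
    have h0 : 0 ≤ |δ| * x := by positivity
    rw [hL]; linarith only [h0]
  have hqL : (q : ℝ) * L ≤ 2 * q + 2 * X5 := by
    rw [hL]; linarith only [hδx]
  -- rewrite the sum with `θ = a/q + δ`
  have hsum : ∑ n ∈ Nat.smoothNumbersUpTo ⌊x⌋₊ (y + 1), (𝐞 ((n : ℝ) * θ) : ℂ) =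
      ∑ n ∈ Nat.smoothNumbersUpTo ⌊x⌋₊ (y + 1), (𝐞 ((n : ℝ) * ((a : ℝ) / q + δ)) : ℂ) := by
    rw [← hθ]
  rw [hsum]
  -- Theorem 1, when applicable
  have hThm1 : (q : ℝ) ^ 2 * L ^ 2 * (y : ℝ) ^ 3 ≤ x → R ≤ q * L →
      ‖∑ n ∈ Nat.smoothNumbersUpTo ⌊x⌋₊ (y + 1), (𝐞 ((n : ℝ) * ((a : ℝ) / q + δ)) : ℂ)‖ ≤ MainB := by
    intro hH hRqL
    have key := hT x y hx₀T hy4 hy6 q hq1 a hcop δ (by rw [← hL]; exact hH)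
    rw [← hαdef, ← hL] at key
    refine key.trans ?_
    rw [hMainB, h𝓟]
    have hqL0 : 0 < (q : ℝ) * L := by positivity
    have h1 : ((q : ℝ) * L) ^ e ≤ R ^ e := Real.rpow_le_rpow_of_nonpos (by linarith) hRqL he0
    have h2 : 0 ≤ C * Real.log x ^ 3 * (y : ℝ) ^ (5 / 2 * (1 - α)) := by positivity
    have h3 : 0 ≤ x ^ α * (smoothZeta α y / Real.sqrt (saddlePhi₂ α y)) := h𝓟0
    calc C * Real.log x ^ 3 * (y : ℝ) ^ (5 / 2 * (1 - α)) * ((q : ℝ) * L) ^ (-(1 / 2 : ℝ) + 3 / 2 * (1 - α)) *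
          (x ^ α * (smoothZeta α y / Real.sqrt (saddlePhi₂ α y)))
        = C * Real.log x ^ 3 * (y : ℝ) ^ (5 / 2 * (1 - α)) * ((q : ℝ) * L) ^ e *
          (x ^ α * (smoothZeta α y / Real.sqrt (saddlePhi₂ α y))) := by rw [he]
      _ ≤ C * Real.log x ^ 3 * (y : ℝ) ^ (5 / 2 * (1 - α)) * R ^ e *
          (x ^ α * (smoothZeta α y / Real.sqrt (saddlePhi₂ α y))) := by
          apply mul_le_mul_of_nonneg_right _ h3
          exact mul_le_mul_of_nonneg_left h1 h2
  ------------------------------------------------------------------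
  -- ### the three cases
  have hgoal : ‖∑ n ∈ Nat.smoothNumbersUpTo ⌊x⌋₊ (y + 1), (𝐞 ((n : ℝ) * ((a : ℝ) / q + δ)) : ℂ)‖ ≤
      MainB + CrudeB := by
    rcases le_or_gt (q : ℝ) (X2 / (4 * (y : ℝ) ^ 2)) with hqsmall | hqlarge
    · -- Theorem 1 applies: `q L ≤ 2q + 2 X5 ≤ X2/(2y²) + 2X5 ≤ X2/y^{3/2}`-ish
      have hH : (q : ℝ) ^ 2 * L ^ 2 * (y : ℝ) ^ 3 ≤ x := by
        -- `qL ≤ X2/(2y²) + 2 X5` and `2X5 ≤ X2/(2y²)` (from `4 y² X5 ≤ X2 = X5² x^{1/10}`… use `y^8 ≤ X5`)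
        have h1 : (q : ℝ) * L ≤ X2 / (2 * (y : ℝ) ^ 2) + 2 * X5 := by
          have : 2 * (q : ℝ) ≤ X2 / (2 * (y : ℝ) ^ 2) := by
            rw [le_div_iff₀ (by positivity)] at hqsmall ⊢; linarith only [hqsmall]
          linarith only [this, hqL]
        have h2 : 2 * X5 ≤ X2 / (2 * (y : ℝ) ^ 2) := by
          rw [le_div_iff₀ (by positivity), hX2_X5]
          have hx10 : (1 : ℝ) ≤ x ^ (1 / 10 : ℝ) := Real.one_le_rpow hx1.le (by norm_num)
          have : 4 * (y : ℝ) ^ 2 ≤ X5 := by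
            have h4 : 4 * (y : ℝ) ^ 2 ≤ (y : ℝ) ^ 3 := by nlinarith only [hy16, sq_nonneg ((y : ℝ))]
            linarith only [h4, hy3_8.trans hy8]
          calc 2 * X5 * (2 * (y : ℝ) ^ 2) = X5 * (4 * (y : ℝ) ^ 2) := by ring
            _ ≤ X5 * X5 := by gcongr
            _ = X5 ^ (2 : ℕ) * 1 := by ring
            _ ≤ X5 ^ (2 : ℕ) * x ^ (1 / 10 : ℝ) := by gcongr
        have h3 : (q : ℝ) * L ≤ X2 / (y : ℝ) ^ 2 := by
          have : X2 / (2 * (y : ℝ) ^ 2) + X2 / (2 * (y : ℝ) ^ 2) = X2 / (y : ℝ) ^ 2 := by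
            field_simp; ring
          linarith only [this, h1, h2]
        have hqL0 : 0 ≤ (q : ℝ) * L := by positivity
        calc (q : ℝ) ^ 2 * L ^ 2 * (y : ℝ) ^ 3 = ((q : ℝ) * L) ^ 2 * (y : ℝ) ^ 3 := by ring
          _ ≤ (X2 / (y : ℝ) ^ 2) ^ 2 * (y : ℝ) ^ 3 := by gcongr
          _ = x / y := by
              field_simp
              rw [← hX2sq]; ring
          _ ≤ x := div_le_self hx0.le hy1
      rcases le_or_gt (q : ℝ) R with hqR | hqR
      · -- `q ≤ R`: minor forces `|δ| > y² R / x`, so `qL ≥ L ≥ 2 |δ| x > 2 y² R ≥ R`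
        have hδbig : R / x < |δ| := by
          have := hminor q hq1 hqR a
          rwa [hδ]
        have hRqL : R ≤ q * L := by
          have h1 : R < |δ| * x := by rwa [div_lt_iff₀ hx0] at hδbig
          have h3 : L ≤ q * L := le_mul_of_one_le_left (by linarith only [hL2]) hq1r
          rw [hL] at h3 ⊢; linarith only [h1, h3, hR1]
        exact (hThm1 hH hRqL).trans (le_add_of_nonneg_right hCrudeB0)
      · -- `R < q`: `qL ≥ 2q > R`
        have hRqL : R ≤ q * L := by
          have : (q : ℝ) ≤ q * L := le_mul_of_one_le_right hq0.le (by linarith only [hL2])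
          linarith only [this, hqR]
        exact (hThm1 hH hRqL).trans (le_add_of_nonneg_right hCrudeB0)
    · -- large `q`: the crude bound with `W₀ = X2`, `K₀ = y`
      have hK : (y : ℝ) * |δ| * (q : ℝ) ^ 2 ≤ y := by
        have h1 : |δ| * (q : ℝ) ^ 2 ≤ 1 := by
          calc |δ| * (q : ℝ) ^ 2 = |δ| * (q * q) := by ring
            _ ≤ |δ| * (q * QD) := by gcongr
            _ ≤ 1 := hδQ
        calc (y : ℝ) * |δ| * (q : ℝ) ^ 2 = (y : ℝ) * (|δ| * (q : ℝ) ^ 2) := by ring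
          _ ≤ (y : ℝ) * 1 := by gcongr
          _ = (y : ℝ) := mul_one _
      have hyX2 : (y : ℝ) ≤ X2 := by
        rw [hX2_X5]
        have hx10 : (1 : ℝ) ≤ x ^ (1 / 10 : ℝ) := Real.one_le_rpow hx1.le (by norm_num)
        have : (y : ℝ) ≤ X5 := by
          calc (y : ℝ) = (y : ℝ) ^ 1 := (pow_one _).symm
            _ ≤ (y : ℝ) ^ (8 : ℕ) := pow_le_pow_right₀ hy1 (by norm_num)
            _ ≤ X5 := hy8
        calc (y : ℝ) ≤ X5 := this
          _ = X5 * 1 * 1 := by ring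
          _ ≤ X5 * X5 * x ^ (1 / 10 : ℝ) := by gcongr
          _ = X5 ^ (2 : ℕ) * x ^ (1 / 10 : ℝ) := by ring
      have hX2x : X2 ≤ x := by
        calc X2 = X2 * 1 := (mul_one _).symm
          _ ≤ X2 * X2 := by gcongr
          _ = x := hX2sq
      have key := norm_smoothExpSum_le_crude (x := x) (W₀ := X2) (K₀ := y) (δ := δ) (y := y) (q := q)
        (a := a) hx16 hy2 hq1 hcop hy1 hK hyX2 hX2x
      refine key.trans (le_add_of_nonneg_of_le hMainB0 ?_)
      -- bound the crude expression by `CrudeB`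
      rw [hCrudeB]
      exact crude_bound_aux hx1 hLx hy1 hq0 hq1r hX2 hQD hqQD hqlarge hlogyL

  calc ‖∑ n ∈ Nat.smoothNumbersUpTo ⌊x⌋₊ (y + 1), (𝐞 ((n : ℝ) * ((a : ℝ) / q + δ)) : ℂ)‖
      ≤ MainB + CrudeB := hgoal
    _ = _ := by rw [hMainB, hCrudeB, he, h𝓟]

end Literature.NumberTheory.Sieve

end
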